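import Mathlib
import HarnessLib
import Literature.NumberTheory.Transcendental.AssociatorsBarEval
import Summits.KontsevichZagierPeriods.KontsevichZagierPeriods.Theorems.FurushoPentagonKernelModuloPeriodConjectureLeafLowWeight
import Summits.KontsevichZagierPeriods.KontsevichZagierPeriods.Theorems.FurushoPentagonKernelModuloPeriodConjectureLeafCert
import Summits.KontsevichZagierPeriods.KontsevichZagierPeriods.Theorems.FurushoPentagonKernelModuloPeriodConjectureLeafTableLow
import Summits.KontsevichZagierPeriods.KontsevichZagierPeriods.Theorems.FurushoPentagonKernelModuloPeriodConjectureLeafWeightFiveA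
import Summits.KontsevichZagierPeriods.KontsevichZagierPeriods.Theorems.FurushoPentagonKernelModuloPeriodConjectureLeafWeightSixA
import Summits.KontsevichZagierPeriods.KontsevichZagierPeriods.Theorems.FurushoPentagonKernelModuloPeriodConjectureLeafWeightSixB
import Summits.KontsevichZagierPeriods.KontsevichZagierPeriods.Theorems.FurushoPentagonKernelModuloPeriodConjectureLeafWeightSixC
import Summits.KontsevichZagierPeriods.KontsevichZagierPeriods.Theorems.FurushoPentagonKernelModuloPeriodConjectureLeafWeightEightA
import Summits.KontsevichZagierPeriods.KontsevichZagierPeriods.Theorems.FurushoPentagonKernelModuloPeriodConjectureLeafWeightEightB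
import Summits.KontsevichZagierPeriods.KontsevichZagierPeriods.Theorems.FurushoPentagonKernelModuloPeriodConjectureLeafWeightEightC
import Summits.KontsevichZagierPeriods.KontsevichZagierPeriods.Theorems.FurushoPentagonKernelModuloPeriodConjectureLeafWeightEightD
import Summits.KontsevichZagierPeriods.KontsevichZagierPeriods.Theorems.FurushoPentagonKernelModuloPeriodConjectureLeafWeightEightE
import Summits.KontsevichZagierPeriods.KontsevichZagierPeriods.Theorems.FurushoPentagonKernelModuloPeriodConjectureLeafWeightEightF
import Summits.KontsevichZagierPeriods.KontsevichZagierPeriods.Theorems.FurushoPentagonKernelModuloPeriodConjectureLeafWeightEightG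
import Summits.KontsevichZagierPeriods.KontsevichZagierPeriods.Theorems.FurushoPentagonKernelModuloPeriodConjectureLeafWeightEightH
import Summits.KontsevichZagierPeriods.KontsevichZagierPeriods.Theorems.FurushoPentagonKernelModuloPeriodConjectureLeafWeightEightI
import Summits.KontsevichZagierPeriods.KontsevichZagierPeriods.Theorems.FurushoPentagonKernelModuloPeriodConjectureLeafWeightEightJ
import Summits.KontsevichZagierPeriods.KontsevichZagierPeriods.Theorems.FurushoPentagonKernelModuloPeriodConjectureLeafWeightEightCertA
import Summits.KontsevichZagierPeriods.KontsevichZagierPeriods.Theorems.FurushoPentagonKernelModuloPeriodConjectureLeafWeightEightCertB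
import Summits.KontsevichZagierPeriods.KontsevichZagierPeriods.Theorems.FurushoPentagonKernelModuloPeriodConjectureLeafWeightEightCertC
import Summits.KontsevichZagierPeriods.KontsevichZagierPeriods.Theorems.FurushoPentagonKernelModuloPeriodConjectureLeafWeightEightCertD
import Summits.KontsevichZagierPeriods.KontsevichZagierPeriods.Theorems.FurushoPentagonKernelModuloPeriodConjectureLeafWeightEightCertE

/-!
# `KernelModuloPeriodConjecture`, line `Sketch`: the algebraic leaf in weight 8

Crux `FurushoPentagon.KernelModuloPeriodConjecture` (stmt-KontsevichZagierPeriods-15058), line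
`Sketch`, registered stub `stub_associatorHoffmanSpanning` (the algebraic leaf
`AssociatorHoffmanSpanning`: Hoffman words span `𝒪(GroupLike ∩ Pent)` weight by weight). This file
proves the **weight-8 slice** unconditionally: for every admissible index `s` of weight 8 an
explicit rational certificate `c_{binaryWord s}(φ) = Σ_t b_t c_{binaryWord t}(φ)` (`t` Hoffman of
the same weight), valid at every group-like solution `φ` of Drinfeld's pentagon equation over every
commutative `ℚ`-algebra (`associatorHoffmanSpanning_of_weight_eq_8`; the identity tables are the part files).

Method. For such `φ`: (i) `c_{x₁}(φ) = 0`, `c_{x₁ⁿ}(φ) = 0` (pentagon: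
`DrinfeldPentagon.apply_letter_eq_zero_of_isGroupLike`, `IsGroupLike.apply_replicate_eq_zero`);
(ii) shuffle products `c_u c_v = Σ_{w ∈ u ш v} c_w` (group-likeness), used for `u = x₁`
(regularisation of the words `x₁w`) and for pairs of convergent words (finite double shuffle);
(iii) the regularised stuffle identities `π_Y(φ)(s) π_Y(φ)(t) = Σ_{u ∈ s ∗ t} π_Y(φ)(u)` for `s`
admissible and `t = (1,…,1)` or `t` admissible — Furusho's double shuffle for pentagon solutions in
the coefficientwise form `DrinfeldPentagon.piY_mul_piY_eq_sum_stuffle` (tree theorem; Furusho 2011,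
§5). Products of lower-weight coefficients are rewritten through the lower-weight tables; the
resulting linear system in the coefficients `c_w`, `w ∈ {x₀,x₁}^{k-1}x₁`, and in the products of
Hoffman coefficients has corank `d_k` (Zagier's dimension) with the Hoffman words free — the
Ihara–Kaneko–Zagier verification of their Conjecture 1 in this weight, here for abstract pentagon
solutions. Certificates were found by exact linear algebra over `ℚ` (lead's generator
`work/gen/genlean.py`, folder of prover-line-stmt-KontsevichZagierPeriods-15058-c1) and are checked
by `linear_combination`; denominators are cleared (`D · c_w = Σ n_t c_t`).

References: K. Ihara, M. Kaneko, D. Zagier, *Derivation and double shuffle relations for multiple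
zeta values*, Compos. Math. 142 (2006), §1–§2 [IharaKanekoZagier2006]; H. Furusho, *Double shuffle
relation for associators*, Ann. of Math. 174 (2011), Thm 1.2, §5 [Furusho2011]; F. Brown, *Mixed
Tate motives over ℤ*, Ann. of Math. 175 (2012), Thm 1.1 [Brown2012].
-/

namespace Summit.KontsevichZagierPeriods.FurushoPentagon.KernelModuloPeriodConjecture

open Literature.NumberTheory.Transcendental

/-- **The algebraic leaf `AssociatorHoffmanSpanning` in weight `8`**: for every admissible index `s` of
weight `8` one finitely supported `b` on Hoffman indices of weight `8` with
`c_{binaryWord s}(φ) = Σ_t b_t c_{binaryWord t}(φ)` at every group-like solution `φ` of Drinfeld's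
pentagon over every (reduced) commutative `ℚ`-algebra — the weight-`8` slice of
`GRT₁ ≅ U^{dR}_{MT(ℤ)}` in coordinates — from Furusho's double shuffle for pentagon solutions and the
Ihara–Kaneko–Zagier regularised double shuffle linear algebra (`d_8 = 4`; reducedness is
not used; Hoffman indices reduce to themselves). [cite: IharaKanekoZagier2006, §2] -/
theorem associatorHoffmanSpanning_of_weight_eq_8 {s : List ℕ} (hs : MZV.IsAdmissible s)
    (hw : MZV.weight s = 8) :
    ∃ b : List ℕ →₀ ℚ, (∀ t ∈ b.support, MZV.IsHoffman t ∧ MZV.weight t = MZV.weight s) ∧ ∀ (R :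
      Type) [CommRing R] [Algebra ℚ R] [IsReduced R] (φ : NCSeries Bool R), NCSeries.IsGroupLike φ →
      NCSeries.DrinfeldPentagon φ → φ (MZV.binaryWord s) = b.sum (fun t q => q • φ (MZV.binaryWord
      t)) := by
  obtain ⟨hpos, hhead⟩ := hs
  match s, hpos, hhead, hw with
  | [], _, _, hw => exact absurd hw (by decide)
  | [a], hpos, hhead, hw =>
    have ha : 2 ≤ a := hhead (by simp)
    have hw' : a = 8 := by simpa [MZV.weight] using hw
    have ha' : a ≤ 8 := by omega
    interval_cases a <;>
      first
        | omega
        | exact leafLowWeight_of_isHoffman (by decide)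
        | exact leafCert_w8_8
  | [a, b], hpos, hhead, hw =>
    have ha : 2 ≤ a := hhead (by simp)
    have hb : 1 ≤ b := hpos b (by simp)
    have hw' : a + b = 8 := by simpa [MZV.weight] using hw
    have ha' : a ≤ 7 := by omega
    have hb' : b ≤ 6 := by omega
    interval_cases a <;> interval_cases b <;>
      first
        | omega
        | exact leafLowWeight_of_isHoffman (by decide)
        | exact leafCert_w8_26
        | exact leafCert_w8_35
        | exact leafCert_w8_44
        | exact leafCert_w8_53
        | exact leafCert_w8_62
        | exact leafCert_w8_71
  | [a, b, c], hpos, hhead, hw =>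
    have ha : 2 ≤ a := hhead (by simp)
    have hb : 1 ≤ b := hpos b (by simp)
    have hc : 1 ≤ c := hpos c (by simp)
    have hw' : a + (b + c) = 8 := by simpa [MZV.weight] using hw
    have ha' : a ≤ 6 := by omega
    have hb' : b ≤ 5 := by omega
    have hc' : c ≤ 5 := by omega
    interval_cases a <;> interval_cases b <;> interval_cases c <;>
      first
        | omega
        | exact leafLowWeight_of_isHoffman (by decide)
        | exact leafCert_w8_215
        | exact leafCert_w8_224
        | exact leafCert_w8_242
        | exact leafCert_w8_251
        | exact leafCert_w8_314
        | exact leafCert_w8_341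
        | exact leafCert_w8_413
        | exact leafCert_w8_422
        | exact leafCert_w8_431
        | exact leafCert_w8_512
        | exact leafCert_w8_521
        | exact leafCert_w8_611
  | [a, b, c, d], hpos, hhead, hw =>
    have ha : 2 ≤ a := hhead (by simp)
    have hb : 1 ≤ b := hpos b (by simp)
    have hc : 1 ≤ c := hpos c (by simp)
    have hd : 1 ≤ d := hpos d (by simp)
    have hw' : a + (b + (c + d)) = 8 := by simpa [MZV.weight] using hw
    have ha' : a ≤ 5 := by omega
    have hb' : b ≤ 4 := by omega
    have hc' : c ≤ 4 := by omega
    have hd' : d ≤ 4 := by omega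
    interval_cases a <;> interval_cases b <;> interval_cases c <;> interval_cases d <;>
      first
        | omega
        | exact leafLowWeight_of_isHoffman (by decide)
        | exact leafCert_w8_2114
        | exact leafCert_w8_2123
        | exact leafCert_w8_2132
        | exact leafCert_w8_2141
        | exact leafCert_w8_2213
        | exact leafCert_w8_2231
        | exact leafCert_w8_2312
        | exact leafCert_w8_2321
        | exact leafCert_w8_2411
        | exact leafCert_w8_3113
        | exact leafCert_w8_3122
        | exact leafCert_w8_3131
        | exact leafCert_w8_3212
        | exact leafCert_w8_3221
        | exact leafCert_w8_3311
        | exact leafCert_w8_4112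
        | exact leafCert_w8_4121
        | exact leafCert_w8_4211
        | exact leafCert_w8_5111
  | [a, b, c, d, e], hpos, hhead, hw =>
    have ha : 2 ≤ a := hhead (by simp)
    have hb : 1 ≤ b := hpos b (by simp)
    have hc : 1 ≤ c := hpos c (by simp)
    have hd : 1 ≤ d := hpos d (by simp)
    have he : 1 ≤ e := hpos e (by simp)
    have hw' : a + (b + (c + (d + e))) = 8 := by simpa [MZV.weight] using hw
    have ha' : a ≤ 4 := by omega
    have hb' : b ≤ 3 := by omega
    have hc' : c ≤ 3 := by omega
    have hd' : d ≤ 3 := by omega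
    have he' : e ≤ 3 := by omega
    interval_cases a <;> interval_cases b <;> interval_cases c <;> interval_cases d <;>
      interval_cases e <;>
      first
        | omega
        | exact leafLowWeight_of_isHoffman (by decide)
        | exact leafCert_w8_21113
        | exact leafCert_w8_21122
        | exact leafCert_w8_21131
        | exact leafCert_w8_21212
        | exact leafCert_w8_21221
        | exact leafCert_w8_21311
        | exact leafCert_w8_22112
        | exact leafCert_w8_22121
        | exact leafCert_w8_22211
        | exact leafCert_w8_23111
        | exact leafCert_w8_31112
        | exact leafCert_w8_31121
        | exact leafCert_w8_31211
        | exact leafCert_w8_32111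
        | exact leafCert_w8_41111
  | [a, b, c, d, e, f], hpos, hhead, hw =>
    have ha : 2 ≤ a := hhead (by simp)
    have hb : 1 ≤ b := hpos b (by simp)
    have hc : 1 ≤ c := hpos c (by simp)
    have hd : 1 ≤ d := hpos d (by simp)
    have he : 1 ≤ e := hpos e (by simp)
    have hf : 1 ≤ f := hpos f (by simp)
    have hw' : a + (b + (c + (d + (e + f)))) = 8 := by simpa [MZV.weight] using hw
    have ha' : a ≤ 3 := by omega
    have hb' : b ≤ 2 := by omega
    have hc' : c ≤ 2 := by omega
    have hd' : d ≤ 2 := by omega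
    have he' : e ≤ 2 := by omega
    have hf' : f ≤ 2 := by omega
    interval_cases a <;> interval_cases b <;> interval_cases c <;> interval_cases d <;>
      interval_cases e <;> interval_cases f <;>
      first
        | omega
        | exact leafLowWeight_of_isHoffman (by decide)
        | exact leafCert_w8_211112
        | exact leafCert_w8_211121
        | exact leafCert_w8_211211
        | exact leafCert_w8_212111
        | exact leafCert_w8_221111
        | exact leafCert_w8_311111
  | [a, b, c, d, e, f, g], hpos, hhead, hw =>
    have ha : 2 ≤ a := hhead (by simp)
    have hb : 1 ≤ b := hpos b (by simp)
    have hc : 1 ≤ c := hpos c (by simp)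
    have hd : 1 ≤ d := hpos d (by simp)
    have he : 1 ≤ e := hpos e (by simp)
    have hf : 1 ≤ f := hpos f (by simp)
    have hg : 1 ≤ g := hpos g (by simp)
    have hw' : a + (b + (c + (d + (e + (f + g))))) = 8 := by simpa [MZV.weight] using hw
    obtain rfl : a = 2 := by omega
    obtain rfl : b = 1 := by omega
    obtain rfl : c = 1 := by omega
    obtain rfl : d = 1 := by omega
    obtain rfl : e = 1 := by omega
    obtain rfl : f = 1 := by omega
    obtain rfl : g = 1 := by omega
    first
        | omega
        | exact leafLowWeight_of_isHoffman (by decide)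
        | exact leafCert_w8_2111111
  | a :: b :: c :: d :: e :: f :: g :: i :: u, hpos, hhead, hw =>
    exfalso
    have ha : 2 ≤ a := hhead (by simp)
    have hb : 1 ≤ b := hpos b (by simp)
    have hc : 1 ≤ c := hpos c (by simp)
    have hd : 1 ≤ d := hpos d (by simp)
    have he : 1 ≤ e := hpos e (by simp)
    have hf : 1 ≤ f := hpos f (by simp)
    have hg : 1 ≤ g := hpos g (by simp)
    have hi : 1 ≤ i := hpos i (by simp)
    have hw' : a + (b + (c + (d + (e + (f + (g + (i + u.sum))))))) = 8 := by simpa [MZV.weight] using hw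
    omega

/-- **Registered stub `stub_leafWeightEight`** of the lead's skeleton (crux stmt-KontsevichZagierPeriods-15058, line
`Sketch`): the weight-`8` slice of the algebraic leaf `AssociatorHoffmanSpanning`, verbatim. [cite: IharaKanekoZagier2006, §2] -/
theorem stub_leafWeightEight : ∀ s : List ℕ, MZV.IsAdmissible s → MZV.weight s = 8 → ∃ b : List ℕ →₀ ℚ, (∀ t ∈ b.support, MZV.IsHoffman t ∧ MZV.weight t = MZV.weight s) ∧ ∀ (R : Type) [CommRing R] [Algebra ℚ R] [IsReduced R] (φ : NCSeries Bool R), NCSeries.IsGroupLike φ → NCSeries.DrinfeldPentagon φ → φ (MZV.binaryWord s) = b.sum (fun t q => q • φ (MZV.binaryWord t)) :=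
  fun _ hs hw => associatorHoffmanSpanning_of_weight_eq_8 hs hw

end Summit.KontsevichZagierPeriods.FurushoPentagon.KernelModuloPeriodConjecture
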